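import Mathlib
import HarnessLib

/-!
# Route `KLProgramme` — crux K3 ENGINE (stmt-HubbardSuperconductivity-20437) stub (b) conj. 2 «(c-D)² FAMILY TELESCOPE», brick (D5m): UNIFORM SIZES
# OF THE COVARIANCE PIECE'S DEFECT POLYNOMIALS AT THE REFERENCE SCALE — `X_k(x₀) ≤ c·(G₀/x₀²)·x₀^k·𝔛_k/Λ²`, `T_t(x₀) ≤ (2π/β)³(G₀/x₀²)𝔗/(cΛ⁵)`,
# and the direction amplitudes `a_{e1} ≤ 𝔞_{e1}/Λ_m`, `a_{e2} ≤ 𝔞_{e2}/Λ_m²`, … (scale-free majorants)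

Cell `gate-hubbard-kl`, seat hubbard-kl-k3c3-p2 (g11); F1-DESIGN §10.  The covariance piece (`…EngineSliceCovPieceTel`) carries the defect polynomials
`X₀…X₃`, the time block `T_t` and the direction amplitudes `A_{e1}…A_{v2}` of `…SectorSliceDefectRowsFat` at the reference-scale increment
`(G₀/x₀², G₁/x₀, G₂, G₃x₀)`.  With the exact ratios `G_k = γ_k G₀`, `G₀ ≤ g₀`, `1 ≤ x₀`, `1 ≤ Λx₀` every `X_k` is `c·(G₀/x₀²)·x₀^k/Λ²` times a
scale-free polynomial; with `ρ_f ≤ ρ_f^M`, `w_{si}Λ_m ≤ w₀`, `Λ_m ≤ 1` the `L`-free amplitudes `a_{e1}…a_{v2}` of `rateAmps_pack'` are `≤ 𝔞/Λ_m^{1,2}`.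

* `covX_le` (the four `X`'s and `T_t`), `covAe_le` (the six amplitudes).

Pure real-arithmetic bookkeeping; no definitions, no sorry. [folklore]
-/

noncomputable section

namespace Summit.HubbardSuperconductivity.HubbardSuperconductivity.Theorems.TorusFourierL2

set_option linter.dupNamespace false -- summit = problem name (single-conjunct summit), D-0017

open Real

set_option maxHeartbeats 4000000 in
/-- **The defect polynomials at the reference scale are `c·(G₀/x₀²)·x₀^k·𝔛_k/Λ²`, the time block is `(2π/β)³(G₀/x₀²)𝔗/(cΛ⁵)`.** [folklore] -/
theorem covX_le {Λ lam c β x₀ G₀ Gi₁ Gi₂ Gi₃ g₀ γ₁ γ₂ γ₃ K₁ K₂ K₃s B₁ B₂ B₃ B₄ Gp₁ Gp₂ Gp₃ X₀s X₁s X₂s X₃s Tts : ℝ}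
    (hΛ : 0 < Λ) (hΛlam : Λ ≤ lam) (hc : 0 < c) (hβ : 0 < β) (hx₀ : 1 ≤ x₀) (hΛx : 1 ≤ Λ * x₀) (hG₀ : 0 ≤ G₀) (hG₀g : G₀ ≤ g₀)
    (hGi₁ : Gi₁ = γ₁ * G₀) (hGi₂ : Gi₂ = γ₂ * G₀) (hGi₃ : Gi₃ = γ₃ * G₀) (hγ₁ : 0 ≤ γ₁) (hγ₂ : 0 ≤ γ₂) (hγ₃ : 0 ≤ γ₃)
    (hK₁ : 0 ≤ K₁) (hK₂ : 0 ≤ K₂) (hK₃s : 0 ≤ K₃s) (hB₁ : 0 ≤ B₁) (hB₂ : 0 ≤ B₂) (hB₃ : 0 ≤ B₃) (hB₄ : 0 ≤ B₄)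
    (hGp₁ : 0 ≤ Gp₁) (hGp₂ : 0 ≤ Gp₂) (hGp₃ : 0 ≤ Gp₃)
    (hX₀s : X₀s = (16 * B₁ + 16) * c / Λ ^ 2 * (G₀ / x₀ ^ 2))
    (hX₁s : X₁s = (32 * B₂ + 144 * B₁ + 128) * c / Λ ^ 3 * (G₀ / x₀ ^ 2) * (K₁ + (Gi₁ / x₀)) + (16 * B₁ + 16) * c / Λ ^ 2 * (Gi₁ / x₀))
    (hX₂s : X₂s = (64 * B₃ + 480 * B₂ + 1728 * B₁ + 1536) * c / Λ ^ 4 * (G₀ / x₀ ^ 2) * (K₁ + (Gi₁ / x₀)) ^ 2 +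
      (32 * B₂ + 144 * B₁ + 128) * c / Λ ^ 3 * ((Gi₁ / x₀) * (2 * K₁ + (Gi₁ / x₀))) +
      ((32 * B₂ + 144 * B₁ + 128) * c / Λ ^ 3 * (G₀ / x₀ ^ 2) * (K₂ + Gi₂) + (16 * B₁ + 16) * c / Λ ^ 2 * Gi₂))
    (hX₃s : X₃s = (128 * B₄ + 1408 * B₃ + 7776 * B₂ + 27648 * B₁ + 24576) * c / Λ ^ 5 * (G₀ / x₀ ^ 2) * (K₁ + (Gi₁ / x₀)) ^ 3 +
      (64 * B₃ + 480 * B₂ + 1728 * B₁ + 1536) * c / Λ ^ 4 * ((Gi₁ / x₀) * (3 * K₁ ^ 2 + 3 * K₁ * (Gi₁ / x₀) + (Gi₁ / x₀) ^ 2)) +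
      3 * ((64 * B₃ + 480 * B₂ + 1728 * B₁ + 1536) * c / Λ ^ 4 * (G₀ / x₀ ^ 2) * ((K₁ + (Gi₁ / x₀)) * (K₂ + Gi₂)) +
        (32 * B₂ + 144 * B₁ + 128) * c / Λ ^ 3 * (K₁ * Gi₂ + (Gi₁ / x₀) * K₂ + (Gi₁ / x₀) * Gi₂)) +
      ((32 * B₂ + 144 * B₁ + 128) * c / Λ ^ 3 * (G₀ / x₀ ^ 2) * ((K₃s * x₀) + (Gi₃ * x₀)) + (16 * B₁ + 16) * c / Λ ^ 2 * (Gi₃ * x₀)))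
    (hTts : Tts = (1 / c) ^ 2 *
      (1 * ((2 * π / β) ^ 3 * ((128 * B₄ + 1216 * B₃ + 6912 * B₂ + 26112 * B₁ + 24576) * c / Λ ^ 5 * (G₀ / x₀ ^ 2))) +
        3 * ((2 * Gp₁ * |2 * π / β| * 1 / lam) * ((2 * π / β) ^ 2 * ((64 * B₃ + 416 * B₂ + 1600 * B₁ + 1536) * c / Λ ^ 4 * (G₀ / x₀ ^ 2)))) +
        3 * (((4 * Gp₂ + 2 * Gp₁) * (2 * π / β) ^ 2 * 1 / lam ^ 2) * ((2 * π / β) * ((32 * B₂ + 128 * B₁ + 128) * c / Λ ^ 3 * (G₀ / x₀ ^ 2)))) +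
        ((8 * Gp₃ + 12 * Gp₂) * |2 * π / β| ^ 3 * 1 / lam ^ 3) * ((16 * B₁ + 16) * c / Λ ^ 2 * (G₀ / x₀ ^ 2)))) :
    0 ≤ X₀s ∧ 0 ≤ X₁s ∧ 0 ≤ X₂s ∧ 0 ≤ X₃s ∧ 0 ≤ Tts ∧
    X₀s = c * (G₀ / x₀ ^ 2) * (16 * B₁ + 16) / Λ ^ 2 ∧
    X₁s ≤ c * (G₀ / x₀ ^ 2) * x₀ * ((32 * B₂ + 144 * B₁ + 128) * (K₁ + γ₁ * g₀) + (16 * B₁ + 16) * γ₁) / Λ ^ 2 ∧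
    X₂s ≤ c * (G₀ / x₀ ^ 2) * x₀ ^ 2 * ((64 * B₃ + 480 * B₂ + 1728 * B₁ + 1536) * (K₁ + γ₁ * g₀) ^ 2 +
      (32 * B₂ + 144 * B₁ + 128) * γ₁ * (2 * K₁ + γ₁ * g₀) + (32 * B₂ + 144 * B₁ + 128) * (K₂ + γ₂ * g₀) + (16 * B₁ + 16) * γ₂) / Λ ^ 2 ∧
    X₃s ≤ c * (G₀ / x₀ ^ 2) * x₀ ^ 3 * ((128 * B₄ + 1408 * B₃ + 7776 * B₂ + 27648 * B₁ + 24576) * (K₁ + γ₁ * g₀) ^ 3 +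
      (64 * B₃ + 480 * B₂ + 1728 * B₁ + 1536) * γ₁ * (3 * K₁ ^ 2 + 3 * K₁ * (γ₁ * g₀) + (γ₁ * g₀) ^ 2) +
      3 * ((64 * B₃ + 480 * B₂ + 1728 * B₁ + 1536) * ((K₁ + γ₁ * g₀) * (K₂ + γ₂ * g₀)) + (32 * B₂ + 144 * B₁ + 128) * (K₁ * γ₂ + γ₁ * K₂ + γ₁ * γ₂ * g₀)) +
      ((32 * B₂ + 144 * B₁ + 128) * (K₃s + γ₃ * g₀) + (16 * B₁ + 16) * γ₃)) / Λ ^ 2 ∧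
    Tts ≤ (2 * π / β) ^ 3 * (G₀ / x₀ ^ 2) * ((128 * B₄ + 1216 * B₃ + 6912 * B₂ + 26112 * B₁ + 24576) + 3 * (2 * Gp₁) * (64 * B₃ + 416 * B₂ + 1600 * B₁ + 1536) +
      3 * (4 * Gp₂ + 2 * Gp₁) * (32 * B₂ + 128 * B₁ + 128) + (8 * Gp₃ + 12 * Gp₂) * (16 * B₁ + 16)) / (c * Λ ^ 5) := by
  have hπ := Real.pi_pos
  have hx₀0 : 0 < x₀ := lt_of_lt_of_le one_pos hx₀
  have hlam : 0 < lam := hΛ.trans_le hΛlam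
  set P : ℝ := G₀ / x₀ ^ 2 with hP
  have hP0 : 0 ≤ P := by positivity
  have hGP : G₀ = P * x₀ ^ 2 := by rw [hP]; field_simp
  have hg₀ : 0 ≤ g₀ := hG₀.trans hG₀g
  -- the increment jets in terms of `P`
  have hGi₁0 : 0 ≤ Gi₁ := by rw [hGi₁]; positivity
  have hGi₂0 : 0 ≤ Gi₂ := by rw [hGi₂]; positivity
  have hGi₃0 : 0 ≤ Gi₃ := by rw [hGi₃]; positivity
  have hP₁e : Gi₁ / x₀ = γ₁ * P * x₀ := by rw [hGi₁, hGP]; field_simp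
  have hP₁0 : 0 ≤ Gi₁ / x₀ := by positivity
  have hG₀x : G₀ / x₀ ≤ g₀ := (div_le_self hG₀ hx₀).trans hG₀g
  have hP₁b : Gi₁ / x₀ ≤ γ₁ * g₀ := by rw [hGi₁, mul_div_assoc]; exact mul_le_mul_of_nonneg_left hG₀x hγ₁
  have hGi₂e : Gi₂ = γ₂ * P * x₀ ^ 2 := by rw [hGi₂, hGP]; ring
  have hGi₂b : Gi₂ ≤ γ₂ * g₀ := by rw [hGi₂]; exact mul_le_mul_of_nonneg_left hG₀g hγ₂
  have hGi₃e : Gi₃ = γ₃ * P * x₀ ^ 2 := by rw [hGi₃, hGP]; ring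
  have hGi₃b : Gi₃ ≤ γ₃ * g₀ := by rw [hGi₃]; exact mul_le_mul_of_nonneg_left hG₀g hγ₃
  have hKP₁ : K₁ + Gi₁ / x₀ ≤ K₁ + γ₁ * g₀ := by linarith
  have hKP₁0 : 0 ≤ K₁ + Gi₁ / x₀ := by positivity
  have hKP₂ : K₂ + Gi₂ ≤ K₂ + γ₂ * g₀ := by linarith
  have hKP₂0 : 0 ≤ K₂ + Gi₂ := by positivity
  -- powers of `1/Λ` against powers of `x₀` (`1 ≤ Λx₀`, `1 ≤ x₀`)
  have hiΛ : 0 < 1 / Λ := by positivity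
  have hux : 1 / Λ ≤ x₀ := by rw [div_le_iff₀ hΛ]; linarith [hΛx]
  have hux3 : 1 / Λ ^ 3 ≤ x₀ ^ 3 := by
    have := pow_le_pow_left₀ hiΛ.le hux 3; rwa [div_pow, one_pow] at this
  have hux2' : 1 / Λ ^ 2 ≤ x₀ ^ 2 := by
    have := pow_le_pow_left₀ hiΛ.le hux 2; rwa [div_pow, one_pow] at this
  have hx2 : x₀ ≤ x₀ ^ 2 := by nlinarith only [hx₀]
  have hx3 : x₀ ^ 2 ≤ x₀ ^ 3 := by nlinarith only [hx₀, hx₀0]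
  have hx13 : x₀ ≤ x₀ ^ 3 := hx2.trans hx3
  -- `1/Λ^{2+a} ≤ x₀^a/Λ²`-type facts
  have f1 : 1 / Λ ^ 3 ≤ x₀ / Λ ^ 2 := by
    rw [show (1 : ℝ) / Λ ^ 3 = (1 / Λ) / Λ ^ 2 by field_simp]; exact div_le_div_of_nonneg_right hux (by positivity)
  have f2 : 1 / Λ ^ 4 ≤ x₀ ^ 2 / Λ ^ 2 := by
    rw [show (1 : ℝ) / Λ ^ 4 = (1 / Λ ^ 2) / Λ ^ 2 by field_simp]; exact div_le_div_of_nonneg_right hux2' (by positivity)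
  have f3 : 1 / Λ ^ 5 ≤ x₀ ^ 3 / Λ ^ 2 := by
    rw [show (1 : ℝ) / Λ ^ 5 = (1 / Λ ^ 3) / Λ ^ 2 by field_simp]; exact div_le_div_of_nonneg_right hux3 (by positivity)
  have f4 : x₀ / Λ ^ 3 ≤ x₀ ^ 2 / Λ ^ 2 := by
    rw [show x₀ / Λ ^ 3 = x₀ * (1 / Λ) / Λ ^ 2 by field_simp, show x₀ ^ 2 = x₀ * x₀ by ring]
    exact div_le_div_of_nonneg_right (mul_le_mul_of_nonneg_left hux hx₀0.le) (by positivity)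
  have f5 : 1 / Λ ^ 3 ≤ x₀ ^ 2 / Λ ^ 2 := f1.trans (div_le_div_of_nonneg_right hx2 (by positivity))
  have f6 : x₀ / Λ ^ 4 ≤ x₀ ^ 3 / Λ ^ 2 := by
    rw [show x₀ / Λ ^ 4 = x₀ * (1 / Λ ^ 2) / Λ ^ 2 by field_simp, show x₀ ^ 3 = x₀ * x₀ ^ 2 by ring]
    exact div_le_div_of_nonneg_right (mul_le_mul_of_nonneg_left hux2' hx₀0.le) (by positivity)
  have f7 : 1 / Λ ^ 4 ≤ x₀ ^ 3 / Λ ^ 2 := f2.trans (div_le_div_of_nonneg_right hx3 (by positivity))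
  have f8 : x₀ ^ 2 / Λ ^ 3 ≤ x₀ ^ 3 / Λ ^ 2 := by
    rw [show x₀ ^ 2 / Λ ^ 3 = x₀ ^ 2 * (1 / Λ) / Λ ^ 2 by field_simp, show x₀ ^ 3 = x₀ ^ 2 * x₀ by ring]
    exact div_le_div_of_nonneg_right (mul_le_mul_of_nonneg_left hux (by positivity)) (by positivity)
  have f9 : x₀ / Λ ^ 3 ≤ x₀ ^ 3 / Λ ^ 2 := f4.trans (div_le_div_of_nonneg_right hx3 (by positivity))
  -- abbreviations for the cutoff polynomials
  set K1 : ℝ := 16 * B₁ + 16 with hK1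
  set K2 : ℝ := 32 * B₂ + 144 * B₁ + 128 with hK2
  set K3 : ℝ := 64 * B₃ + 480 * B₂ + 1728 * B₁ + 1536 with hK3
  set K4 : ℝ := 128 * B₄ + 1408 * B₃ + 7776 * B₂ + 27648 * B₁ + 24576 with hK4
  have hK10 : 0 ≤ K1 := by positivity
  have hK20 : 0 ≤ K2 := by positivity
  have hK30 : 0 ≤ K3 := by positivity
  have hK40 : 0 ≤ K4 := by positivity
  refine ⟨by rw [hX₀s]; positivity, by rw [hX₁s]; positivity, by rw [hX₂s]; positivity, by rw [hX₃s]; positivity, by rw [hTts]; positivity,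
    by rw [hX₀s]; ring, ?_, ?_, ?_, ?_⟩
  · -- `X₁`
    rw [hX₁s]
    have t1 : K2 * c / Λ ^ 3 * P * (K₁ + Gi₁ / x₀) ≤ c * P * x₀ * (K2 * (K₁ + γ₁ * g₀)) / Λ ^ 2 := by
      calc K2 * c / Λ ^ 3 * P * (K₁ + Gi₁ / x₀) = (K2 * c * P) * ((K₁ + Gi₁ / x₀) * (1 / Λ ^ 3)) := by ring
        _ ≤ (K2 * c * P) * ((K₁ + γ₁ * g₀) * (x₀ / Λ ^ 2)) :=
            mul_le_mul_of_nonneg_left (mul_le_mul hKP₁ f1 (by positivity) (by positivity)) (by positivity)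
        _ = _ := by ring
    have t2 : K1 * c / Λ ^ 2 * (Gi₁ / x₀) = c * P * x₀ * (K1 * γ₁) / Λ ^ 2 := by rw [hP₁e]; ring
    calc _ ≤ c * P * x₀ * (K2 * (K₁ + γ₁ * g₀)) / Λ ^ 2 + c * P * x₀ * (K1 * γ₁) / Λ ^ 2 := by rw [← t2]; exact add_le_add t1 le_rfl
      _ = _ := by ring
  · -- `X₂`
    rw [hX₂s]
    have t1 : K3 * c / Λ ^ 4 * P * (K₁ + Gi₁ / x₀) ^ 2 ≤ c * P * x₀ ^ 2 * (K3 * (K₁ + γ₁ * g₀) ^ 2) / Λ ^ 2 := by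
      calc K3 * c / Λ ^ 4 * P * (K₁ + Gi₁ / x₀) ^ 2 = (K3 * c * P) * ((K₁ + Gi₁ / x₀) ^ 2 * (1 / Λ ^ 4)) := by ring
        _ ≤ (K3 * c * P) * ((K₁ + γ₁ * g₀) ^ 2 * (x₀ ^ 2 / Λ ^ 2)) :=
            mul_le_mul_of_nonneg_left (mul_le_mul (pow_le_pow_left₀ hKP₁0 hKP₁ 2) f2 (by positivity) (by positivity)) (by positivity)
        _ = _ := by ring
    have t2 : K2 * c / Λ ^ 3 * ((Gi₁ / x₀) * (2 * K₁ + Gi₁ / x₀)) ≤ c * P * x₀ ^ 2 * (K2 * γ₁ * (2 * K₁ + γ₁ * g₀)) / Λ ^ 2 := by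
      rw [hP₁e] at hP₁b ⊢
      have h2 : 2 * K₁ + γ₁ * P * x₀ ≤ 2 * K₁ + γ₁ * g₀ := by linarith
      calc K2 * c / Λ ^ 3 * (γ₁ * P * x₀ * (2 * K₁ + γ₁ * P * x₀)) = (K2 * c * γ₁ * P) * ((2 * K₁ + γ₁ * P * x₀) * (x₀ / Λ ^ 3)) := by ring
        _ ≤ (K2 * c * γ₁ * P) * ((2 * K₁ + γ₁ * g₀) * (x₀ ^ 2 / Λ ^ 2)) :=
            mul_le_mul_of_nonneg_left (mul_le_mul h2 f4 (by positivity) (by positivity)) (by positivity)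
        _ = _ := by ring
    have t3 : K2 * c / Λ ^ 3 * P * (K₂ + Gi₂) ≤ c * P * x₀ ^ 2 * (K2 * (K₂ + γ₂ * g₀)) / Λ ^ 2 := by
      calc K2 * c / Λ ^ 3 * P * (K₂ + Gi₂) = (K2 * c * P) * ((K₂ + Gi₂) * (1 / Λ ^ 3)) := by ring
        _ ≤ (K2 * c * P) * ((K₂ + γ₂ * g₀) * (x₀ ^ 2 / Λ ^ 2)) :=
            mul_le_mul_of_nonneg_left (mul_le_mul hKP₂ f5 (by positivity) (by positivity)) (by positivity)
        _ = _ := by ring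
    have t4 : K1 * c / Λ ^ 2 * Gi₂ = c * P * x₀ ^ 2 * (K1 * γ₂) / Λ ^ 2 := by rw [hGi₂e]; ring
    calc _ ≤ c * P * x₀ ^ 2 * (K3 * (K₁ + γ₁ * g₀) ^ 2) / Λ ^ 2 + c * P * x₀ ^ 2 * (K2 * γ₁ * (2 * K₁ + γ₁ * g₀)) / Λ ^ 2 +
          (c * P * x₀ ^ 2 * (K2 * (K₂ + γ₂ * g₀)) / Λ ^ 2 + c * P * x₀ ^ 2 * (K1 * γ₂) / Λ ^ 2) := by
          rw [← t4]; exact add_le_add (add_le_add t1 t2) (add_le_add t3 le_rfl)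
      _ = _ := by ring
  · -- `X₃`
    rw [hX₃s]
    have t1 : K4 * c / Λ ^ 5 * P * (K₁ + Gi₁ / x₀) ^ 3 ≤ c * P * x₀ ^ 3 * (K4 * (K₁ + γ₁ * g₀) ^ 3) / Λ ^ 2 := by
      calc K4 * c / Λ ^ 5 * P * (K₁ + Gi₁ / x₀) ^ 3 = (K4 * c * P) * ((K₁ + Gi₁ / x₀) ^ 3 * (1 / Λ ^ 5)) := by ring
        _ ≤ (K4 * c * P) * ((K₁ + γ₁ * g₀) ^ 3 * (x₀ ^ 3 / Λ ^ 2)) :=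
            mul_le_mul_of_nonneg_left (mul_le_mul (pow_le_pow_left₀ hKP₁0 hKP₁ 3) f3 (by positivity) (by positivity)) (by positivity)
        _ = _ := by ring
    have t2 : K3 * c / Λ ^ 4 * ((Gi₁ / x₀) * (3 * K₁ ^ 2 + 3 * K₁ * (Gi₁ / x₀) + (Gi₁ / x₀) ^ 2)) ≤
        c * P * x₀ ^ 3 * (K3 * γ₁ * (3 * K₁ ^ 2 + 3 * K₁ * (γ₁ * g₀) + (γ₁ * g₀) ^ 2)) / Λ ^ 2 := by
      have hq : 3 * K₁ ^ 2 + 3 * K₁ * (Gi₁ / x₀) + (Gi₁ / x₀) ^ 2 ≤ 3 * K₁ ^ 2 + 3 * K₁ * (γ₁ * g₀) + (γ₁ * g₀) ^ 2 := by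
        nlinarith only [hP₁b, hP₁0, hK₁]
      have hq0 : 0 ≤ 3 * K₁ ^ 2 + 3 * K₁ * (Gi₁ / x₀) + (Gi₁ / x₀) ^ 2 := by positivity
      calc K3 * c / Λ ^ 4 * ((Gi₁ / x₀) * (3 * K₁ ^ 2 + 3 * K₁ * (Gi₁ / x₀) + (Gi₁ / x₀) ^ 2))
          = (K3 * c * γ₁ * P) * ((3 * K₁ ^ 2 + 3 * K₁ * (Gi₁ / x₀) + (Gi₁ / x₀) ^ 2) * (x₀ / Λ ^ 4)) := by rw [hP₁e]; ring
        _ ≤ (K3 * c * γ₁ * P) * ((3 * K₁ ^ 2 + 3 * K₁ * (γ₁ * g₀) + (γ₁ * g₀) ^ 2) * (x₀ ^ 3 / Λ ^ 2)) :=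
            mul_le_mul_of_nonneg_left (mul_le_mul hq f6 (by positivity) (by positivity)) (by positivity)
        _ = _ := by ring
    have t3 : K3 * c / Λ ^ 4 * P * ((K₁ + Gi₁ / x₀) * (K₂ + Gi₂)) ≤ c * P * x₀ ^ 3 * (K3 * ((K₁ + γ₁ * g₀) * (K₂ + γ₂ * g₀))) / Λ ^ 2 := by
      calc K3 * c / Λ ^ 4 * P * ((K₁ + Gi₁ / x₀) * (K₂ + Gi₂)) = (K3 * c * P) * (((K₁ + Gi₁ / x₀) * (K₂ + Gi₂)) * (1 / Λ ^ 4)) := by ring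
        _ ≤ (K3 * c * P) * (((K₁ + γ₁ * g₀) * (K₂ + γ₂ * g₀)) * (x₀ ^ 3 / Λ ^ 2)) :=
            mul_le_mul_of_nonneg_left (mul_le_mul (mul_le_mul hKP₁ hKP₂ hKP₂0 (by positivity)) f7 (by positivity) (by positivity)) (by positivity)
        _ = _ := by ring
    have t4 : K2 * c / Λ ^ 3 * (K₁ * Gi₂ + (Gi₁ / x₀) * K₂ + (Gi₁ / x₀) * Gi₂) ≤ c * P * x₀ ^ 3 * (K2 * (K₁ * γ₂ + γ₁ * K₂ + γ₁ * γ₂ * g₀)) / Λ ^ 2 := by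
      have e : K₁ * Gi₂ + (Gi₁ / x₀) * K₂ + (Gi₁ / x₀) * Gi₂ = P * (K₁ * γ₂ * x₀ ^ 2 + γ₁ * K₂ * x₀ + γ₁ * x₀ * Gi₂) := by
        rw [hP₁e, hGi₂e]; ring
      have hin : K₁ * γ₂ * x₀ ^ 2 + γ₁ * K₂ * x₀ + γ₁ * x₀ * Gi₂ ≤ (K₁ * γ₂ + γ₁ * K₂ + γ₁ * γ₂ * g₀) * x₀ ^ 2 := by
        have u1 : γ₁ * K₂ * x₀ ≤ γ₁ * K₂ * x₀ ^ 2 := mul_le_mul_of_nonneg_left hx2 (by positivity)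
        have u2 : γ₁ * x₀ * Gi₂ ≤ γ₁ * x₀ ^ 2 * (γ₂ * g₀) := mul_le_mul (mul_le_mul_of_nonneg_left hx2 hγ₁) hGi₂b hGi₂0 (by positivity)
        nlinarith only [u1, u2]
      rw [e]
      calc K2 * c / Λ ^ 3 * (P * (K₁ * γ₂ * x₀ ^ 2 + γ₁ * K₂ * x₀ + γ₁ * x₀ * Gi₂))
          = (K2 * c * P) * ((K₁ * γ₂ * x₀ ^ 2 + γ₁ * K₂ * x₀ + γ₁ * x₀ * Gi₂) * (1 / Λ ^ 3)) := by ring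
        _ ≤ (K2 * c * P) * (((K₁ * γ₂ + γ₁ * K₂ + γ₁ * γ₂ * g₀) * x₀ ^ 2) * (1 / Λ ^ 3)) :=
            mul_le_mul_of_nonneg_left (mul_le_mul_of_nonneg_right hin (by positivity)) (by positivity)
        _ = (K2 * c * P) * ((K₁ * γ₂ + γ₁ * K₂ + γ₁ * γ₂ * g₀) * (x₀ ^ 2 / Λ ^ 3)) := by ring
        _ ≤ (K2 * c * P) * ((K₁ * γ₂ + γ₁ * K₂ + γ₁ * γ₂ * g₀) * (x₀ ^ 3 / Λ ^ 2)) :=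
            mul_le_mul_of_nonneg_left (mul_le_mul_of_nonneg_left f8 (by positivity)) (by positivity)
        _ = _ := by ring
    have t5 : K2 * c / Λ ^ 3 * P * (K₃s * x₀ + Gi₃ * x₀) ≤ c * P * x₀ ^ 3 * (K2 * (K₃s + γ₃ * g₀)) / Λ ^ 2 := by
      have hin : K₃s * x₀ + Gi₃ * x₀ ≤ (K₃s + γ₃ * g₀) * x₀ := by nlinarith only [hGi₃b, hx₀0]
      calc K2 * c / Λ ^ 3 * P * (K₃s * x₀ + Gi₃ * x₀) = (K2 * c * P) * ((K₃s * x₀ + Gi₃ * x₀) * (1 / Λ ^ 3)) := by ring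
        _ ≤ (K2 * c * P) * (((K₃s + γ₃ * g₀) * x₀) * (1 / Λ ^ 3)) := mul_le_mul_of_nonneg_left (mul_le_mul_of_nonneg_right hin (by positivity)) (by positivity)
        _ = (K2 * c * P) * ((K₃s + γ₃ * g₀) * (x₀ / Λ ^ 3)) := by ring
        _ ≤ (K2 * c * P) * ((K₃s + γ₃ * g₀) * (x₀ ^ 3 / Λ ^ 2)) := mul_le_mul_of_nonneg_left (mul_le_mul_of_nonneg_left f9 (by positivity)) (by positivity)
        _ = _ := by ring
    have t6 : K1 * c / Λ ^ 2 * (Gi₃ * x₀) = c * P * x₀ ^ 3 * (K1 * γ₃) / Λ ^ 2 := by rw [hGi₃e]; ring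
    calc _ ≤ c * P * x₀ ^ 3 * (K4 * (K₁ + γ₁ * g₀) ^ 3) / Λ ^ 2 + c * P * x₀ ^ 3 * (K3 * γ₁ * (3 * K₁ ^ 2 + 3 * K₁ * (γ₁ * g₀) + (γ₁ * g₀) ^ 2)) / Λ ^ 2 +
          3 * (c * P * x₀ ^ 3 * (K3 * ((K₁ + γ₁ * g₀) * (K₂ + γ₂ * g₀))) / Λ ^ 2 + c * P * x₀ ^ 3 * (K2 * (K₁ * γ₂ + γ₁ * K₂ + γ₁ * γ₂ * g₀)) / Λ ^ 2) +
          (c * P * x₀ ^ 3 * (K2 * (K₃s + γ₃ * g₀)) / Λ ^ 2 + c * P * x₀ ^ 3 * (K1 * γ₃) / Λ ^ 2) := by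
          rw [← t6]
          exact add_le_add (add_le_add (add_le_add t1 t2) (mul_le_mul_of_nonneg_left (add_le_add t3 t4) (by norm_num))) (add_le_add t5 le_rfl)
      _ = _ := by ring
  · -- `T_t`: `1/Λ_m ≤ 1/Λ`, `|2π/β| = 2π/β`
    rw [hTts]
    have hab : |2 * π / β| = 2 * π / β := abs_of_pos (by positivity)
    rw [hab]
    have il1 : 1 / lam ≤ 1 / Λ := one_div_le_one_div_of_le hΛ hΛlam
    have il2 : 1 / lam ^ 2 ≤ 1 / Λ ^ 2 := one_div_le_one_div_of_le (by positivity) (pow_le_pow_left₀ hΛ.le hΛlam 2)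
    have il3 : 1 / lam ^ 3 ≤ 1 / Λ ^ 3 := one_div_le_one_div_of_le (by positivity) (pow_le_pow_left₀ hΛ.le hΛlam 3)
    have t1 : (1 / c) ^ 2 * (1 * ((2 * π / β) ^ 3 * ((128 * B₄ + 1216 * B₃ + 6912 * B₂ + 26112 * B₁ + 24576) * c / Λ ^ 5 * P))) =
        (2 * π / β) ^ 3 * P * (128 * B₄ + 1216 * B₃ + 6912 * B₂ + 26112 * B₁ + 24576) / (c * Λ ^ 5) := by field_simp
    have t2 : (1 / c) ^ 2 * (3 * ((2 * Gp₁ * (2 * π / β) * 1 / lam) * ((2 * π / β) ^ 2 * ((64 * B₃ + 416 * B₂ + 1600 * B₁ + 1536) * c / Λ ^ 4 * P)))) ≤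
        (2 * π / β) ^ 3 * P * (3 * (2 * Gp₁) * (64 * B₃ + 416 * B₂ + 1600 * B₁ + 1536)) / (c * Λ ^ 5) := by
      have e : (1 / c) ^ 2 * (3 * ((2 * Gp₁ * (2 * π / β) * 1 / lam) * ((2 * π / β) ^ 2 * ((64 * B₃ + 416 * B₂ + 1600 * B₁ + 1536) * c / Λ ^ 4 * P)))) =
          ((2 * π / β) ^ 3 * P * (3 * (2 * Gp₁) * (64 * B₃ + 416 * B₂ + 1600 * B₁ + 1536)) / (c * Λ ^ 4)) * (1 / lam) := by field_simp
      have e' : (2 * π / β) ^ 3 * P * (3 * (2 * Gp₁) * (64 * B₃ + 416 * B₂ + 1600 * B₁ + 1536)) / (c * Λ ^ 5) =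
          ((2 * π / β) ^ 3 * P * (3 * (2 * Gp₁) * (64 * B₃ + 416 * B₂ + 1600 * B₁ + 1536)) / (c * Λ ^ 4)) * (1 / Λ) := by field_simp
      rw [e, e']; exact mul_le_mul_of_nonneg_left il1 (by positivity)
    have t3 : (1 / c) ^ 2 * (3 * (((4 * Gp₂ + 2 * Gp₁) * (2 * π / β) ^ 2 * 1 / lam ^ 2) * ((2 * π / β) * ((32 * B₂ + 128 * B₁ + 128) * c / Λ ^ 3 * P)))) ≤
        (2 * π / β) ^ 3 * P * (3 * (4 * Gp₂ + 2 * Gp₁) * (32 * B₂ + 128 * B₁ + 128)) / (c * Λ ^ 5) := by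
      have e : (1 / c) ^ 2 * (3 * (((4 * Gp₂ + 2 * Gp₁) * (2 * π / β) ^ 2 * 1 / lam ^ 2) * ((2 * π / β) * ((32 * B₂ + 128 * B₁ + 128) * c / Λ ^ 3 * P)))) =
          ((2 * π / β) ^ 3 * P * (3 * (4 * Gp₂ + 2 * Gp₁) * (32 * B₂ + 128 * B₁ + 128)) / (c * Λ ^ 3)) * (1 / lam ^ 2) := by field_simp
      have e' : (2 * π / β) ^ 3 * P * (3 * (4 * Gp₂ + 2 * Gp₁) * (32 * B₂ + 128 * B₁ + 128)) / (c * Λ ^ 5) =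
          ((2 * π / β) ^ 3 * P * (3 * (4 * Gp₂ + 2 * Gp₁) * (32 * B₂ + 128 * B₁ + 128)) / (c * Λ ^ 3)) * (1 / Λ ^ 2) := by field_simp
      rw [e, e']; exact mul_le_mul_of_nonneg_left il2 (by positivity)
    have t4 : (1 / c) ^ 2 * (((8 * Gp₃ + 12 * Gp₂) * (2 * π / β) ^ 3 * 1 / lam ^ 3) * ((16 * B₁ + 16) * c / Λ ^ 2 * P)) ≤
        (2 * π / β) ^ 3 * P * ((8 * Gp₃ + 12 * Gp₂) * (16 * B₁ + 16)) / (c * Λ ^ 5) := by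
      have e : (1 / c) ^ 2 * (((8 * Gp₃ + 12 * Gp₂) * (2 * π / β) ^ 3 * 1 / lam ^ 3) * ((16 * B₁ + 16) * c / Λ ^ 2 * P)) =
          ((2 * π / β) ^ 3 * P * ((8 * Gp₃ + 12 * Gp₂) * (16 * B₁ + 16)) / (c * Λ ^ 2)) * (1 / lam ^ 3) := by field_simp
      have e' : (2 * π / β) ^ 3 * P * ((8 * Gp₃ + 12 * Gp₂) * (16 * B₁ + 16)) / (c * Λ ^ 5) =
          ((2 * π / β) ^ 3 * P * ((8 * Gp₃ + 12 * Gp₂) * (16 * B₁ + 16)) / (c * Λ ^ 2)) * (1 / Λ ^ 3) := by field_simp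
      rw [e, e']; exact mul_le_mul_of_nonneg_left il3 (by positivity)
    rw [mul_add, mul_add, mul_add, t1]
    calc _ ≤ (2 * π / β) ^ 3 * P * (128 * B₄ + 1216 * B₃ + 6912 * B₂ + 26112 * B₁ + 24576) / (c * Λ ^ 5) +
          (2 * π / β) ^ 3 * P * (3 * (2 * Gp₁) * (64 * B₃ + 416 * B₂ + 1600 * B₁ + 1536)) / (c * Λ ^ 5) +
          (2 * π / β) ^ 3 * P * (3 * (4 * Gp₂ + 2 * Gp₁) * (32 * B₂ + 128 * B₁ + 128)) / (c * Λ ^ 5) +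
          (2 * π / β) ^ 3 * P * ((8 * Gp₃ + 12 * Gp₂) * (16 * B₁ + 16)) / (c * Λ ^ 5) := add_le_add (add_le_add (add_le_add le_rfl t2) t3) t4
      _ = _ := by field_simp; ring

/-- **The `L`-free direction amplitudes are `≤ 𝔞/Λ_m`, `𝔞/Λ_m²`** (slots of `rateAmps_pack'`, with `ρ_f ≤ ρ_f^M`, `w_{si}Λ_m ≤ w₀`, `Λ_m ≤ 1`). [folklore] -/
theorem covAe_le {lam A Ba Kp wsi w₀ ρf ρfM Gp₁ Gp₂ ae1 ae2 an1 an2 av1 av2 : ℝ} (hlam : 0 < lam) (hlam1 : lam ≤ 1) (hA : 0 ≤ A) (hBa : 0 ≤ Ba)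
    (hKp : 0 ≤ Kp) (hwsi : 0 ≤ wsi) (hw : wsi * lam ≤ w₀) (hρf : 0 ≤ ρf) (hρfM : ρf ≤ ρfM) (hGp₁ : 0 ≤ Gp₁) (hGp₂ : 0 ≤ Gp₂)
    (hae1 : ae1 = 2 * Gp₁ * ((4 + 2 * A) * (2 * π) + Kp * (ρf + 4 * π) * (2 * π)) / lam + 9 * (4 * Ba * ((1 + 2 * wsi) * (2 * (2 * π)))))
    (hae2 : ae2 = (4 * Gp₂ + 2 * Gp₁) * ((4 + 2 * A) * (2 * π) + Kp * (ρf + 4 * π) * (2 * π)) ^ 2 / lam ^ 2 + 2 * Gp₁ * (Kp * (2 * π) ^ 2) / lam +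
      4 * Gp₁ * ((4 + 2 * A) * (2 * π) + Kp * (ρf + 4 * π) * (2 * π)) / lam * (9 * (4 * Ba * ((1 + 2 * wsi) * (2 * (2 * π))))) +
      9 * (4 * Ba * ((1 + 2 * wsi) * (2 * (2 * π)))) ^ 2 + 8 * Ba ^ 2 * ((1 + 2 * wsi) * (2 * (2 * π))) ^ 2)
    (han1 : an1 = 2 * Gp₁ * ((4 + 2 * A) * (5 * π) + Kp * (ρf + 10 * π) * (5 * π)) / lam + 9 * (4 * Ba * ((1 + 2 * wsi) * (2 * (5 * π)))))
    (han2 : an2 = (4 * Gp₂ + 2 * Gp₁) * ((4 + 2 * A) * (5 * π) + Kp * (ρf + 10 * π) * (5 * π)) ^ 2 / lam ^ 2 + 2 * Gp₁ * (Kp * (5 * π) ^ 2) / lam +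
      4 * Gp₁ * ((4 + 2 * A) * (5 * π) + Kp * (ρf + 10 * π) * (5 * π)) / lam * (9 * (4 * Ba * ((1 + 2 * wsi) * (2 * (5 * π))))) +
      9 * (4 * Ba * ((1 + 2 * wsi) * (2 * (5 * π)))) ^ 2 + 8 * Ba ^ 2 * ((1 + 2 * wsi) * (2 * (5 * π))) ^ 2)
    (hav1 : av1 = 2 * Gp₁ * ((2 * π) * (4 + 2 * A) + Kp * (ρf + 10 * π) * (5 * π)) / lam + 9 * (4 * Ba * ((1 + 2 * wsi) * (2 * (5 * π)))))
    (hav2 : av2 = (4 * Gp₂ + 2 * Gp₁) * ((2 * π) * (4 + 2 * A) + Kp * (ρf + 10 * π) * (5 * π)) ^ 2 / lam ^ 2 + 2 * Gp₁ * (Kp * (5 * π) ^ 2) / lam +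
      4 * Gp₁ * ((2 * π) * (4 + 2 * A) + Kp * (ρf + 10 * π) * (5 * π)) / lam * (9 * (4 * Ba * ((1 + 2 * wsi) * (2 * (5 * π))))) +
      9 * (4 * Ba * ((1 + 2 * wsi) * (2 * (5 * π)))) ^ 2 + 8 * Ba ^ 2 * ((1 + 2 * wsi) * (2 * (5 * π))) ^ 2) :
    ae1 ≤ (2 * Gp₁ * ((4 + 2 * A) * (2 * π) + Kp * (ρfM + 4 * π) * (2 * π)) + 9 * (4 * Ba * ((1 + 2 * w₀) * (2 * (2 * π))))) / lam ∧
    ae2 ≤ ((4 * Gp₂ + 2 * Gp₁) * ((4 + 2 * A) * (2 * π) + Kp * (ρfM + 4 * π) * (2 * π)) ^ 2 + 2 * Gp₁ * (Kp * (2 * π) ^ 2) +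
      4 * Gp₁ * ((4 + 2 * A) * (2 * π) + Kp * (ρfM + 4 * π) * (2 * π)) * (9 * (4 * Ba * ((1 + 2 * w₀) * (2 * (2 * π))))) +
      9 * (4 * Ba * ((1 + 2 * w₀) * (2 * (2 * π)))) ^ 2 + 8 * Ba ^ 2 * ((1 + 2 * w₀) * (2 * (2 * π))) ^ 2) / lam ^ 2 ∧
    an1 ≤ (2 * Gp₁ * ((4 + 2 * A) * (5 * π) + Kp * (ρfM + 10 * π) * (5 * π)) + 9 * (4 * Ba * ((1 + 2 * w₀) * (2 * (5 * π))))) / lam ∧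
    an2 ≤ ((4 * Gp₂ + 2 * Gp₁) * ((4 + 2 * A) * (5 * π) + Kp * (ρfM + 10 * π) * (5 * π)) ^ 2 + 2 * Gp₁ * (Kp * (5 * π) ^ 2) +
      4 * Gp₁ * ((4 + 2 * A) * (5 * π) + Kp * (ρfM + 10 * π) * (5 * π)) * (9 * (4 * Ba * ((1 + 2 * w₀) * (2 * (5 * π))))) +
      9 * (4 * Ba * ((1 + 2 * w₀) * (2 * (5 * π)))) ^ 2 + 8 * Ba ^ 2 * ((1 + 2 * w₀) * (2 * (5 * π))) ^ 2) / lam ^ 2 ∧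
    av1 ≤ (2 * Gp₁ * ((2 * π) * (4 + 2 * A) + Kp * (ρfM + 10 * π) * (5 * π)) + 9 * (4 * Ba * ((1 + 2 * w₀) * (2 * (5 * π))))) / lam ∧
    av2 ≤ ((4 * Gp₂ + 2 * Gp₁) * ((2 * π) * (4 + 2 * A) + Kp * (ρfM + 10 * π) * (5 * π)) ^ 2 + 2 * Gp₁ * (Kp * (5 * π) ^ 2) +
      4 * Gp₁ * ((2 * π) * (4 + 2 * A) + Kp * (ρfM + 10 * π) * (5 * π)) * (9 * (4 * Ba * ((1 + 2 * w₀) * (2 * (5 * π))))) +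
      9 * (4 * Ba * ((1 + 2 * w₀) * (2 * (5 * π)))) ^ 2 + 8 * Ba ^ 2 * ((1 + 2 * w₀) * (2 * (5 * π))) ^ 2) / lam ^ 2 := by
  have hπ := Real.pi_pos
  have hw₀ : 0 ≤ w₀ := (mul_nonneg hwsi hlam.le).trans hw
  have hil : 1 ≤ 1 / lam := by rw [le_div_iff₀ hlam]; linarith
  -- `1 + 2w_{si} ≤ (1 + 2w₀)/Λ_m`
  have hW : 1 + 2 * wsi ≤ (1 + 2 * w₀) / lam := by
    rw [le_div_iff₀ hlam]; nlinarith only [hw, hlam1, hlam, hwsi]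
  have hW0 : 0 ≤ 1 + 2 * wsi := by positivity
  -- generic first / second order shapes
  have first : ∀ {p q θ : ℝ}, 0 ≤ p → 0 ≤ q → 0 ≤ θ →
      2 * Gp₁ * (p * (4 + 2 * A) + Kp * (ρf + q) * θ) / lam + 9 * (4 * Ba * ((1 + 2 * wsi) * (2 * θ))) ≤
        (2 * Gp₁ * (p * (4 + 2 * A) + Kp * (ρfM + q) * θ) + 9 * (4 * Ba * ((1 + 2 * w₀) * (2 * θ)))) / lam := by
    intro p q θ hp hq hθ
    rw [add_div]
    have u1 : 2 * Gp₁ * (p * (4 + 2 * A) + Kp * (ρf + q) * θ) / lam ≤ 2 * Gp₁ * (p * (4 + 2 * A) + Kp * (ρfM + q) * θ) / lam := by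
      gcongr
    have u2 : 9 * (4 * Ba * ((1 + 2 * wsi) * (2 * θ))) ≤ 9 * (4 * Ba * ((1 + 2 * w₀) * (2 * θ))) / lam := by
      rw [show 9 * (4 * Ba * ((1 + 2 * w₀) * (2 * θ))) / lam = 9 * (4 * Ba * (((1 + 2 * w₀) / lam) * (2 * θ))) by ring]
      gcongr
    exact add_le_add u1 u2
  have second : ∀ {p q θ : ℝ}, 0 ≤ p → 0 ≤ q → 0 ≤ θ →
      (4 * Gp₂ + 2 * Gp₁) * (p * (4 + 2 * A) + Kp * (ρf + q) * θ) ^ 2 / lam ^ 2 + 2 * Gp₁ * (Kp * θ ^ 2) / lam +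
        4 * Gp₁ * (p * (4 + 2 * A) + Kp * (ρf + q) * θ) / lam * (9 * (4 * Ba * ((1 + 2 * wsi) * (2 * θ)))) +
        9 * (4 * Ba * ((1 + 2 * wsi) * (2 * θ))) ^ 2 + 8 * Ba ^ 2 * ((1 + 2 * wsi) * (2 * θ)) ^ 2 ≤
      ((4 * Gp₂ + 2 * Gp₁) * (p * (4 + 2 * A) + Kp * (ρfM + q) * θ) ^ 2 + 2 * Gp₁ * (Kp * θ ^ 2) +
        4 * Gp₁ * (p * (4 + 2 * A) + Kp * (ρfM + q) * θ) * (9 * (4 * Ba * ((1 + 2 * w₀) * (2 * θ)))) +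
        9 * (4 * Ba * ((1 + 2 * w₀) * (2 * θ))) ^ 2 + 8 * Ba ^ 2 * ((1 + 2 * w₀) * (2 * θ)) ^ 2) / lam ^ 2 := by
    intro p q θ hp hq hθ
    set E : ℝ := p * (4 + 2 * A) + Kp * (ρf + q) * θ with hE
    set EM : ℝ := p * (4 + 2 * A) + Kp * (ρfM + q) * θ with hEM
    have hE0 : 0 ≤ E := by positivity
    have hEE : E ≤ EM := by rw [hE, hEM]; gcongr
    have hEM0 : 0 ≤ EM := hE0.trans hEE
    have hil2 : 1 ≤ 1 / lam ^ 2 := by rw [le_div_iff₀ (by positivity)]; nlinarith only [hlam1, hlam]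
    have hl12 : 1 / lam ≤ 1 / lam ^ 2 := by
      rw [div_le_div_iff₀ hlam (by positivity)]; nlinarith only [hlam1, hlam]
    have v1 : (4 * Gp₂ + 2 * Gp₁) * E ^ 2 / lam ^ 2 ≤ (4 * Gp₂ + 2 * Gp₁) * EM ^ 2 / lam ^ 2 := by gcongr
    have v2 : 2 * Gp₁ * (Kp * θ ^ 2) / lam ≤ 2 * Gp₁ * (Kp * θ ^ 2) / lam ^ 2 := by
      rw [div_eq_mul_one_div, div_eq_mul_one_div _ (lam ^ 2)]; exact mul_le_mul_of_nonneg_left hl12 (by positivity)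
    have v3 : 4 * Gp₁ * E / lam * (9 * (4 * Ba * ((1 + 2 * wsi) * (2 * θ)))) ≤ 4 * Gp₁ * EM * (9 * (4 * Ba * ((1 + 2 * w₀) * (2 * θ)))) / lam ^ 2 := by
      have w1 : 4 * Gp₁ * E / lam ≤ 4 * Gp₁ * EM / lam := by gcongr
      have w2 : 9 * (4 * Ba * ((1 + 2 * wsi) * (2 * θ))) ≤ 9 * (4 * Ba * (((1 + 2 * w₀) / lam) * (2 * θ))) := by gcongr
      calc 4 * Gp₁ * E / lam * (9 * (4 * Ba * ((1 + 2 * wsi) * (2 * θ)))) ≤ 4 * Gp₁ * EM / lam * (9 * (4 * Ba * (((1 + 2 * w₀) / lam) * (2 * θ)))) :=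
            mul_le_mul w1 w2 (by positivity) (div_nonneg (mul_nonneg (by positivity) hEM0) hlam.le)
        _ = _ := by field_simp
    have v4 : 9 * (4 * Ba * ((1 + 2 * wsi) * (2 * θ))) ^ 2 ≤ 9 * (4 * Ba * ((1 + 2 * w₀) * (2 * θ))) ^ 2 / lam ^ 2 := by
      calc 9 * (4 * Ba * ((1 + 2 * wsi) * (2 * θ))) ^ 2 ≤ 9 * (4 * Ba * (((1 + 2 * w₀) / lam) * (2 * θ))) ^ 2 := by gcongr
        _ = _ := by field_simp
    have v5 : 8 * Ba ^ 2 * ((1 + 2 * wsi) * (2 * θ)) ^ 2 ≤ 8 * Ba ^ 2 * ((1 + 2 * w₀) * (2 * θ)) ^ 2 / lam ^ 2 := by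
      calc 8 * Ba ^ 2 * ((1 + 2 * wsi) * (2 * θ)) ^ 2 ≤ 8 * Ba ^ 2 * (((1 + 2 * w₀) / lam) * (2 * θ)) ^ 2 := by gcongr
        _ = _ := by field_simp
    rw [add_div, add_div, add_div, add_div]
    linarith [v1, v2, v3, v4, v5]
  have e2π : (4 + 2 * A) * (2 * π) = (2 * π) * (4 + 2 * A) := mul_comm _ _
  have e5π : (4 + 2 * A) * (5 * π) = (5 * π) * (4 + 2 * A) := mul_comm _ _
  refine ⟨?_, ?_, ?_, ?_, ?_, ?_⟩
  · rw [hae1, e2π]; exact first (p := 2 * π) (q := 4 * π) (θ := 2 * π) (by positivity) (by positivity) (by positivity)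
  · rw [hae2, e2π]; exact second (p := 2 * π) (q := 4 * π) (θ := 2 * π) (by positivity) (by positivity) (by positivity)
  · rw [han1, e5π]; exact first (p := 5 * π) (q := 10 * π) (θ := 5 * π) (by positivity) (by positivity) (by positivity)
  · rw [han2, e5π]; exact second (p := 5 * π) (q := 10 * π) (θ := 5 * π) (by positivity) (by positivity) (by positivity)
  · rw [hav1]; exact first (p := 2 * π) (q := 10 * π) (θ := 5 * π) (by positivity) (by positivity) (by positivity)
  · rw [hav2]; exact second (p := 2 * π) (q := 10 * π) (θ := 5 * π) (by positivity) (by positivity) (by positivity)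

end Summit.HubbardSuperconductivity.HubbardSuperconductivity.Theorems.TorusFourierL2

end
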